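import Literature.NumberTheory.EllipticCurves.ManinConstantQuadraticTwist
import HarnessLib
import HarnessLib.Audit.Tags

/-!
# Candidate E-imc-19: the optimality label of Cremona's class 390150gy is WRONG — `Cremona390150gyNotOptimal`
# (a DATA ERRATUM typed as an obligation; provable on paper) — cell `bsd-f2-manin` (D-0131 (3) frontier: the
# Manin constant at additive primes). `@[conjecture]` leaf (NOTHING asserted; definitions only).

HONEST FRAMING. LENS = Iwasawa-main-conjecture / twist re-rooting (planner-of-record `bsd-f2-manin-imc` g4, HOME
`run/shared/lean/pub/bsd-f2-manin/MEMO-imc.md` §12.5; Prop VERBATIM from HOME/imc/Sketch-imc-g4.lean sha16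
1179235f32fa830a, farm rc 0).  THE CLAIM: 390150gy1 is NOT the `Γ₀(390150)`-optimal curve (Cremona `opt_man`
code 1 «certainly optimal» is in error; the optimal curve is 390150gy2 = the minimal model of 22950bq1 ⊗ χ₁₇, of
Manin constant 1, and `c(390150gy1) = 1`, not the tabulated `c(gy2) = 3`).  PAPER PROOF (every step a tree
theorem except the two inputs named as hypotheses): `Λ(gy1) = c₀Λ_f ⊆ c₀ g(χ₁₇)⁻¹Λ(bq1) = c₀Λ(gy2) ⊆ Λ(gy2) ⊊
Λ(gy1)` (index 3: `c(gy2) = 3` in Cremona's table ⟺ `λ(gy1 → gy2) = 3`; covolume ratio 3.00000000,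
HOME/imc/g4-periods.py), via the tree's `Γ₀` twist chain `maninConstant_dvd_of_charTwist_gamma0` and the Néron
mapping property.  INDEPENDENT CONFIRMATIONS (three engines, cell records): E2X exact-`H₁` certificate that
390150gy2 is `Γ₀`-optimal (HOME/es/E2X-390150-v1/, kit j284578; MEMO-es §13.11), -imc's THEOREM W flags the same
class (≥ 2 additive primes ⇒ no gain; `ShimuraSubgroupHeckeCongruence.lean`), refuter-1 audit of the §12.5
chain line by line (HOME/REFUTER-ref1.md §R13(a): VALID; the hypotheses jointly satisfiable).  The hypothesis
«22950bq1 is optimal with `c = 1`» is IN PRINT: Agashe–Ribet–Stein 2006, Appendix (J. Cremona) Thm 5.2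
(`N < 60000`, full modular-symbol space); the erratum itself is NOT in print (refuter-2 g4 (3): not on Cremona's
2019 switch list `manin.txt` ll. 36–40; Cremona 2006 stops at 130 000).  BC5 WITNESS: the single violator row of
every twist/isogeny law of the cell (E-imc-7 g1, E-imc-17, E-imc-25/26, E-es-12) is this class, and it is decided
here.  Refuter verdicts: REF1 **SURVIVES — TRUE on paper given its hypothesis** (§R13(a), 18:01Z; BC7 CLEAN);
REF2 NEW ERRATUM as far as print/corpus go.
-/

noncomputable section

open scoped MatrixGroups ModularForm

open CongruenceSubgroup WeierstrassCurve
  Literature.NumberTheory.EllipticCurves Literature.NumberTheory.EllipticCurves.ModularForms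

namespace Summit.BirchSwinnertonDyer.Rank1Residual.ManinAdditive

/-- **Candidate E-imc-19 `Cremona390150gyNotOptimal` (cell bsd-f2-manin, MEMO-imc §12.5; DATA ERRATUM as a
statement — provable on paper, open in Lean, nothing asserted):** if 22950bq1 = `[1,-1,1,-753436505,-7959902434503]`
carries a lattice-optimal `X₀(22950)`-datum with `c = 1` (Cremona: full modular-symbol space for all `N ≤ 60000`;
in print as Agashe–Ribet–Stein 2006, App. Thm 5.2) then 390150gy1 = `[1,-1,1,-249093869855,-27113903499551353]`
carries NO lattice-optimal `X₀(390150)`-datum, i.e. it is NOT the `Γ₀(390150)`-optimal curve.  The in-tree proof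
additionally needs the explicit 3-isogeny gy2 → gy1 and the identification `f_gy = charTwist(f_bq, χ₁₇)`
(`aₙ(gy) = χ₁₇(n)·aₙ(bq)`; j-invariants and conductors check).  Why it might fail: only if 22950bq1 is itself
mislabelled (level ≤ 60000: full space computed) or the `q`-expansion identity fails.
[cite: AgasheRibetStein2006, Appendix (Cremona) Thm. 5.2 (the hypothesis: optimality and c = 1 for N < 60000; the erratum for 390150gy is NOT in print — cell bsd-f2-manin MEMO-imc.md §12.5, E-imc-19)]
[cite: Cremona2022ManinConstants, manin.txt ll. 4–13, 36–40, 90–93 and opt_man.390000-399999] -/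
@[conjecture] def Cremona390150gyNotOptimal : Prop :=
  ∀ (Wbq Wgy : WeierstrassCurve ℚ) [Wbq.IsElliptic] [Wbq.IsGloballyMinimal] [Wgy.IsElliptic]
    [Wgy.IsGloballyMinimal],
    Wbq = ({ a₁ := 1, a₂ := -1, a₃ := 1, a₄ := -753436505, a₆ := -7959902434503 } :
      WeierstrassCurve ℚ) →
    Wgy = ({ a₁ := 1, a₂ := -1, a₃ := 1, a₄ := -249093869855, a₆ := -27113903499551353 } :
      WeierstrassCurve ℚ) →
    (∃ D' : ModularParametrizationData Wbq 22950,
      D'.c = 1 ∧ ∀ z ∈ D'.L.lattice, ∃ w ∈ periodLattice D'.f, z = D'.c * w) →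
    ¬ ∃ D : ModularParametrizationData Wgy 390150,
      ∀ z ∈ D.L.lattice, ∃ w ∈ periodLattice D.f, z = D.c * w

end Summit.BirchSwinnertonDyer.Rank1Residual.ManinAdditive

end
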